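import Summits.HodgeConjecture.HodgeConjecture.Theorems.DworkReflectionQuotientsK2OfTopCharacter

/-!
# Glue item `FlatClassesOfTopCharacterAndTypeOne` of the split of crux K2 (route `DworkReflectionQuotients`)

Route `route-HodgeConjecture-DworkReflectionQuotients` (cell `hodge-nonav`, rung F-H1 — never summit
credit), glue item `stmt-HodgeConjecture-21153` of the split (rev 5) of crux K2
`FlatClassesSpannedByReflectionInvariants` (stmt-HodgeConjecture-20241) into the children
`TopCharacterTrivial` (stmt-21151) and `TypeOneHodge` (stmt-21152). The glue
`TopCharacterTrivial → TypeOneHodge → FlatClassesSpannedByReflectionInvariants` is LITERALLY the landed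
theorem `flatClassesSpannedByReflectionInvariants_of_topCharacter_of_typeOne` (p550660, prover seat
`hodge-nonav-20241-p1` g3): the two binders `hZ`, `hJ1` of that theorem are the two child statements
verbatim. Prover seat `hodge-nonav-20241-p1` (g4), 2026-08-27; `--workitem stmt-HodgeConjecture-21153`.

## References

* N. M. Katz, *Another look at the Dwork family*, Progr. Math. 270 (2009), §3, Lemma 3.1. [Katz2009]
* G. Bini, A. Garbagnati, *Quotients of the Dwork pencil*, J. Geom. Phys. 75 (2014), §3.4. [BiniGarbagnati2012]
-/

namespace Summit.HodgeConjecture.HodgeConjecture.Theorems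

/-- **Glue of the split of crux K2**: `TopCharacterTrivial → TypeOneHodge →
FlatClassesSpannedByReflectionInvariants` — the `Γ_W`-character of `H^{4,0}(X_ψ)` being trivial
(child 1) and the type-`(1,2,2,3,5,5)` eigenclasses being `(2,2)` (child 2) imply the crux (the flat
types `j = 0, 2, 3` by the equivariant transport and the Hodge–Riemann sign argument, `j = 1` by
hypothesis, then the six-reflection averaging). By name: the landed
`flatClassesSpannedByReflectionInvariants_of_topCharacter_of_typeOne`. Relies on nothing unproved.
[cite: Katz2009, §3 and Lemma 3.1] [cite: BiniGarbagnati2012, §3.4] -/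
theorem flatClassesOfTopCharacterAndTypeOne_proof :
    Summit.HodgeConjecture.HodgeConjecture.Theses.DworkReflectionQuotients.FlatClassesOfTopCharacterAndTypeOne :=
  flatClassesSpannedByReflectionInvariants_of_topCharacter_of_typeOne

end Summit.HodgeConjecture.HodgeConjecture.Theorems
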